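import Summits.QuantumFields.YangMills.Theses.ColdStartUniversality
import HarnessLib

/-!
# Route `ColdStartUniversality` (rev 3): the banked crux K_A1 `UniformColdStartMixing`
# (stmt-QuantumFields-24809) implies the centre-neutral crux K_A1|Γ `NeutralColdStartMixing`
# (stmt-QuantumFields-27363) a fortiori

Helper file (seat `ym-line-csu-p1`).  `NeutralColdStartMixing` is `UniformColdStartMixing` asked only for loop
strings of even total winding in every direction of the torus; dropping that hypothesis gives the implication
(`neutralColdStartMixing_of_uniform`), so every file landed toward 24809 (shared Cesàro step `cesaroStep`,
`pinskerStep`, the rung reductions) serves 27363 verbatim.  Pure logic; no definition, no sorry.  RECORD-rung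
R3 plumbing; neither crux is proved here; the YM mass gap is NOT proved. -/

set_option autoImplicit false

namespace Summit.QuantumFields.YangMills.Theorems.ColdStartUniversality

/-- **K_A1 ⇒ K_A1|Γ**: cut-off-uniform cold-start mixing of ALL loop strings implies it for the centre-neutral
ones. [folklore] -/
theorem neutralColdStartMixing_of_uniform
    (h : Summit.QuantumFields.YangMills.Theses.ColdStartUniversality.UniformColdStartMixing) :
    Summit.QuantumFields.YangMills.Theses.ColdStartUniversality.NeutralColdStartMixing := by
  obtain ⟨γ₁, hγ₁, hU⟩ := h
  exact ⟨γ₁, hγ₁, fun F γ hγ hγle os _heven δ hδ => hU F γ hγ hγle os δ hδ⟩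

end Summit.QuantumFields.YangMills.Theorems.ColdStartUniversality
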